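import Summits.CriticalPhenomena.PercolationContinuityZ3.Theses.PercNonProliferation
import Summits.CriticalPhenomena.PercolationContinuityZ3.Theorems.PercNonProliferationFreeBoxPowerSavingConfinedQuasiGiants
import Summits.CriticalPhenomena.PercolationContinuityZ3.Theorems.PercNonProliferationFreeBoxPowerSavingBdryQuasiGiantLeWall
import HarnessLib

/-!
# Crux `PercNonProliferation.FreeBoxPowerSaving` (stmt-CriticalPhenomena-4447), line
# `boundary-interior-split-fat-finite-clusters` — exchange rates for the two open stubs (routes W and F)

Supports (does not close) the crux.  The line's skeleton (`Cruxes/FreeBoxPowerSaving/Lines/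
boundary_interior_split_fat_finite_clusters.lean`, v3) proves the crux from the two registered open stubs
(B) `stub_boundaryQuasiGiantsNotAS` (eventually `P_{p_c}(BQG_n(n^{3-a})) ≤ 1 - ε`: no fat in-box piece touching
`∂ⁱⁿΛ_n` with probability `≥ ε`) and (I₁) `stub_confinedQuasiGiantsVanish` (`P_{p_c}(IQG_n(n^{3-a})) → 0`: no fat
in-box piece avoiding `∂ⁱⁿΛ_n`).  This file kernel-checks the two SUFFICIENT routes found by the lead
(gen 1 continuation c2) and their exchange rates, so that planners and the half-space routes
(PercLowPointHalfSpace, PercBoundarySqueeze) can read off exactly which input on the floor-rooted half-space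
cluster `U = C_ℍ(0)`, resp. on the finite critical cluster `C(0)`, would close each stub:

* ROUTE W — `boundaryQuasiGiantsNotAS_of_fatWallFeetSparse`: (B) follows from `FatWallFeetSparse(a, ε)` =
  "eventually `6(2n+1)² · P_{p_c}(n^{3-a} ≤ #{y ∈ Λ_{2n} : 0 ↔_ℍ y}) ≤ 1 - ε`" (the expected number of boundary
  sites of `Λ_n` whose wall cluster is fat at scale `n` is `≤ 1 - ε`), over the landed transport
  `FreeBoxPowerSavingLine.stub_bdryQuasiGiant_le_wall` (p105790, every `p`);
  `fatWallFeetSparse_of_volumeTail`: a polynomial volume tail `P_{p_c}(t ≤ #{y ∈ Λ_r : 0 ↔_ℍ y}) ≤ C r^{km}/t^k`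
  with `k (3 - m) > 4` gives `FatWallFeetSparse((3-m)/2, 1/2)`.  `k = 1` NEVER qualifies (the first-moment
  route to (B) is dead at every wall-mass exponent `m`); with orthodox exponents (`E|U ∩ Λ_r|^k ≍ r^{k d_f - x_s}`,
  `d_f = 2.523`, `x_s = 0.975`) the hypothesis is true and qualifying exactly for `k ≥ 7`.
* ROUTE F — `confinedQuasiGiantsVanish_of_finiteClusterTail`: (I₁) follows from ANY power-law upper tail of
  the FINITE critical cluster volume, `P_{p_c}(|C(0)| < ∞ ∧ s ≤ |C(0)|) ≤ C s^{-c₀}` (`c₀ > 0`), over the landed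
  first-moment reduction `FreeBoxPowerSavingLine.confinedQuasiGiantsVanish_of_centredRate` (p99710).
Neither hypothesis is in the tree or in print for `d = 3` (Hutchcroft 2020, arXiv:1901.10363, Thm 1.1 is
conditional on the route-F hypothesis; Aizenman–Newman tree-graph bounds control the route-W moments only
through truncated bulk ball sums `Σ_{y ∈ Λ_r} τ(z,y)`, for which nothing below `r³` is known at `p_c`).
-/

noncomputable section

open MeasureTheory Filter Topology
open scoped Classical
open Literature.Probability.Percolation Literature.Probability.LatticeModels

namespace Summit.CriticalPhenomena.PercolationContinuityZ3.FreeBoxPowerSavingLine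

namespace ExchangeRates

/-- Real arithmetic of the volume-tail exchange rate: if `0 ≤ P ≤ C (2n)^{km} / (n^{3-a})^k` with
`a = (3-m)/2` and `n ≥ 1`, then `6 (2n+1)² P ≤ 54 C⁺ 2^{km} · n^{-(k(3-m)/2 - 2)}`. -/
theorem feet_arith {k : ℕ} {m C P n : ℝ} (hn : 1 ≤ n) (hP0 : 0 ≤ P)
    (hP : P ≤ C * (2 * n) ^ ((k : ℝ) * m) / (n ^ (3 - (3 - m) / 2)) ^ k) :
    6 * (2 * n + 1) ^ 2 * P ≤
      54 * max C 0 * (2 : ℝ) ^ ((k : ℝ) * m) * n ^ (-((k : ℝ) * (3 - m) / 2 - 2)) := by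
  have hn0 : 0 < n := by linarith
  set A : ℝ := (2 * n) ^ ((k : ℝ) * m) with hA
  set D : ℝ := (n ^ (3 - (3 - m) / 2)) ^ k with hD
  have hA0 : 0 ≤ A := Real.rpow_nonneg (by linarith) _
  have hD0 : 0 < D := pow_pos (Real.rpow_pos_of_pos hn0 _) k
  have hAD : 0 ≤ A / D := div_nonneg hA0 hD0.le
  have hP' : P ≤ max C 0 * (A / D) := by
    calc P ≤ C * A / D := hP
      _ = C * (A / D) := by ring
      _ ≤ max C 0 * (A / D) := mul_le_mul_of_nonneg_right (le_max_left _ _) hAD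
  have hsq : (2 * n + 1) ^ 2 ≤ 9 * n ^ (2 : ℝ) := by
    rw [Real.rpow_two]
    nlinarith
  have hA' : A = (2 : ℝ) ^ ((k : ℝ) * m) * n ^ ((k : ℝ) * m) := by
    rw [hA, Real.mul_rpow (by norm_num) hn0.le]
  have hD' : D = n ^ ((3 - (3 - m) / 2) * k) := by
    rw [hD, ← Real.rpow_natCast, ← Real.rpow_mul hn0.le]
  have hexp : n ^ (2 : ℝ) * n ^ ((k : ℝ) * m) / n ^ ((3 - (3 - m) / 2) * k) =
      n ^ (-((k : ℝ) * (3 - m) / 2 - 2)) := by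
    rw [← Real.rpow_add hn0, ← Real.rpow_sub hn0]
    congr 1
    ring
  calc 6 * (2 * n + 1) ^ 2 * P ≤ 6 * (9 * n ^ (2 : ℝ)) * (max C 0 * (A / D)) := by
        gcongr
    _ = 54 * max C 0 * (2 : ℝ) ^ ((k : ℝ) * m) *
          (n ^ (2 : ℝ) * n ^ ((k : ℝ) * m) / n ^ ((3 - (3 - m) / 2) * k)) := by
        rw [hA', hD']; ring
    _ = 54 * max C 0 * (2 : ℝ) ^ ((k : ℝ) * m) * n ^ (-((k : ℝ) * (3 - m) / 2 - 2)) := by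
        rw [hexp]

/-- **Exchange rate for route W (kernel-checked): a polynomial volume tail for the floor-rooted
half-space cluster gives the hypothesis `FatWallFeetSparse` of
`boundaryQuasiGiantsNotAS_of_fatWallFeetSparse`.**  If for some `k : ℕ`, `m`, `C` with `k (3 - m) > 4`,
for all `r ≥ 1` and `t > 0`,
`P_{p_c}(t ≤ #{y ∈ Λ_r : 0 ↔ y inside ℍ}) ≤ C r^{km} / t^k`
(the Markov form of a `k`-th moment bound `E_{p_c}[#{y ∈ Λ_r : 0 ↔_ℍ y}^k] ≤ C r^{km}`), then the
expected number of fat wall feet satisfies `6(2n+1)² P_{p_c}(n^{3-a} ≤ #{y ∈ Λ_{2n} : 0 ↔_ℍ y}) ≤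
54 C⁺ 2^{km} n^{2 - k(3-m)/2} → 0` with `a = (3-m)/2`, so `FatWallFeetSparse(a, 1/2)` holds.
`k = 1` never qualifies (`3 - m > 4` is impossible for a volume exponent `m ≥ 0`: the first-moment /
Markov route to (B) is dead at every wall-mass exponent); orthodox values `E|U ∩ Λ_r|^k ≍
r^{k d_f - x_s}`, `d_f = 2.523`, `x_s = 0.975` make the hypothesis true iff `k m ≥ k d_f - x_s`, compatible
with `k(3-m) > 4` exactly for `k ≥ 7`. -/
theorem fatWallFeetSparse_of_volumeTail :
    ∀ (k : ℕ) (m C : ℝ), 4 < (k : ℝ) * (3 - m) →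
    (∀ r : ℕ, 1 ≤ r → ∀ t : ℝ, 0 < t →
      (bondPercolation (zdGraph 3) (criticalProbI 3)).real
          {ω | t ≤ (((box 3 r).filter fun y =>
            ω ∈ openConnIn {x : Site 3 | 0 ≤ x 0} (0 : Site 3) y).card : ℝ)}
        ≤ C * (r : ℝ) ^ ((k : ℝ) * m) / t ^ k) →
    ∃ a ε : ℝ, 0 < a ∧ 0 < ε ∧ ∀ᶠ n : ℕ in atTop,
      6 * (2 * (n : ℝ) + 1) ^ 2 *
          (bondPercolation (zdGraph 3) (criticalProbI 3)).real
            {ω | (n : ℝ) ^ (3 - a) ≤ (((box 3 (2 * n)).filter fun y =>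
              ω ∈ openConnIn {x : Site 3 | 0 ≤ x 0} (0 : Site 3) y).card : ℝ)}
        ≤ 1 - ε := by
  intro k m C hkm hTail
  have h3m : 0 < 3 - m := by
    by_contra h
    push Not at h
    have : (k : ℝ) * (3 - m) ≤ 0 := mul_nonpos_of_nonneg_of_nonpos (Nat.cast_nonneg k) h
    linarith
  refine ⟨(3 - m) / 2, 1 / 2, by positivity, by norm_num, ?_⟩
  set e : ℝ := (k : ℝ) * (3 - m) / 2 - 2 with he_def
  have he : 0 < e := by rw [he_def]; linarith
  set K : ℝ := 54 * max C 0 * (2 : ℝ) ^ ((k : ℝ) * m) with hK_def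
  have hlim : Tendsto (fun n : ℕ => K * (n : ℝ) ^ (-e)) atTop (𝓝 0) := by
    have h := ((tendsto_rpow_neg_atTop he).comp tendsto_natCast_atTop_atTop).const_mul K
    simpa using h
  have hev : ∀ᶠ n : ℕ in atTop, K * (n : ℝ) ^ (-e) ≤ 1 / 2 :=
    hlim.eventually (ge_mem_nhds (by norm_num))
  filter_upwards [hev, eventually_ge_atTop 1] with n hn hn1
  have hN1 : (1 : ℝ) ≤ n := by exact_mod_cast hn1
  have hN0 : (0 : ℝ) < n := by linarith
  have ht : 0 < (n : ℝ) ^ (3 - (3 - m) / 2) := Real.rpow_pos_of_pos hN0 _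
  have hP := hTail (2 * n) (by omega) _ ht
  have hcast : ((2 * n : ℕ) : ℝ) = 2 * (n : ℝ) := by push_cast; ring
  rw [hcast] at hP
  calc 6 * (2 * (n : ℝ) + 1) ^ 2 *
        (bondPercolation (zdGraph 3) (criticalProbI 3)).real
          {ω | (n : ℝ) ^ (3 - (3 - m) / 2) ≤ (((box 3 (2 * n)).filter fun y =>
            ω ∈ openConnIn {x : Site 3 | 0 ≤ x 0} (0 : Site 3) y).card : ℝ)}
      ≤ K * (n : ℝ) ^ (-e) := feet_arith hN1 measureReal_nonneg hP
    _ ≤ 1 / 2 := hn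
    _ = 1 - 1 / 2 := by norm_num

end ExchangeRates

open ExchangeRates

/-- **Route W: (B) from "fat wall clusters have few feet in expectation" (sorry-free glue over the
transport stub).**  HYPOTHESIS `FatWallFeetSparse(a, ε)`: for some `a, ε > 0`, eventually in `n`,
`6 (2n+1)² · P_{p_c}(n^{3-a} ≤ #{y ∈ Λ_{2n} : 0 ↔ y inside ℍ}) ≤ 1 - ε`,
i.e. the expected number of sites `w ∈ ∂ⁱⁿΛ_n` whose WALL CLUSTER `C_{ℍ(w)}(w)` (the cluster of the
floor point `w` in the closed half-space of a face through `w` containing `Λ_n`) has `≥ n^{3-a}`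
vertices within sup-distance `2n` is at most `1 - ε`.  This is a statement about ONE floor-rooted
half-space cluster `U = C_ℍ(0)` — the object of route PercLowPointHalfSpace (stmt-0911/0912/0913) and of
PercBoundarySqueeze (stmt-6983) — a.s. finite at `p_c` by Barsky–Grimmett–Newman
(`BarskyGrimmettNewman1991_Z3_holds`).  Orthodox value: `P(|U ∩ Λ_{2n}| ≥ n^{3-a})` is `π_s(n) ≍ n^{-x_s}`
times a LARGE-DEVIATION factor (typical tall-`U` volume `n^{d_f} = n^{2.52} ≪ n^{3-a}` for `a < 0.48`),
so the hypothesis holds asymptotically with `ε → 1`, but only in the regime `n^{0.48 - a} ≫ 1` (beyond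
Monte-Carlo reach: at accessible `n` a fat wall-hung piece has `≍ n^{1.09}` feet, kit j010718).
Calibration (why it is open): Markov on the volume with the TRUE exponents gives only
`54 n² · n^{d_f - x_s} / n^{3-a} = 54 n^{0.55 + a}` (`E|U ∩ Λ_{2n}| ≍ n^{d_f - x_s} = n^{1.55}`), and with
the filed items `TallClusterMassBound` (m = 11/4) + `QuantitativeBGN` (a₀ ≤ x_s) only
`n^{2 - 1/4 - a₀ + a}`; a `k`-th moment / volume-tail input `P(t ≤ |U ∩ Λ_r|) ≤ C r^{km} t^{-k}` gives
it iff `k (3 - m) > 4` (`fatWallFeetSparse_of_volumeTail` below), orthodox-true for `k ≥ 7`; no such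
bound is in the tree or in print for `d = 3`.  The hypothesis is FALSE at `p = 1` (the count is
`6(2n+1)² ≥ 6`), true below `p_c`, NOT implied by the crux (it is a rate at density `n^{-2}`, and any
crux witness has `a ≤ 2`, Disproof §5). -/
theorem boundaryQuasiGiantsNotAS_of_fatWallFeetSparse :
    (∃ a ε : ℝ, 0 < a ∧ 0 < ε ∧ ∀ᶠ n : ℕ in atTop,
      6 * (2 * (n : ℝ) + 1) ^ 2 *
          (bondPercolation (zdGraph 3) (criticalProbI 3)).real
            {ω | (n : ℝ) ^ (3 - a) ≤ (((box 3 (2 * n)).filter fun y =>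
              ω ∈ openConnIn {x : Site 3 | 0 ≤ x 0} (0 : Site 3) y).card : ℝ)}
        ≤ 1 - ε) →
    ∃ a ε : ℝ, 0 < a ∧ 0 < ε ∧ ∀ᶠ n : ℕ in atTop,
      (bondPercolation (zdGraph 3) (criticalProbI 3)).real
          {ω | ∃ u ∈ innerBoundary (zdGraph 3) (box 3 n),
            (n : ℝ) ^ (3 - a) ≤
              (((box 3 n).filter fun v => ω ∈ openConnIn ↑(box 3 n) u v).card : ℝ)}
        ≤ 1 - ε := by
  rintro ⟨a, ε, ha, hε, hev⟩
  refine ⟨a, ε, ha, hε, ?_⟩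
  filter_upwards [hev] with n hn
  exact (FreeBoxPowerSavingLine.stub_bdryQuasiGiant_le_wall (criticalProbI 3) n ((n : ℝ) ^ (3 - a))).trans hn


/-- **Exchange rate for the interior residual (kernel-checked): ANY power-law upper tail for the
volume of the FINITE critical cluster gives (I₁).**  If for some `c₀ > 0` and `C`,
`P_{p_c}(|C(0)| < ∞ ∧ s ≤ |C(0)|) ≤ C s^{-c₀}` for all real `s ≥ 1` ("`1/δ > 0` for finite clusters" — a
jump-free statement: in a `θ(p_c) > 0` world it constrains only the finite clusters; it is NOT implied by
the crux and does not imply it), then `stub_confinedQuasiGiantsVanish` holds with `a = min(c₀,1)/2`: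
the centred event of the landed first-moment reduction
(`FreeBoxPowerSavingLine.confinedQuasiGiantsVanish_of_centredRate`, p99710) is contained in
`{|C(0)| < ∞ ∧ n^{3-a} ≤ |C(0)|}`, so `n^a · P(centred) ≤ C⁺ n^{a - (3-a)c₀} → 0`.  No such tail bound is
known for `ℤ³` (Hutchcroft 2020, arXiv:1901.10363, Thm 1.1 is conditional on exactly this hypothesis;
the tree and the located literature have only the Aizenman–Barsky LOWER bound `≥ c s^{-1/2}`). -/
theorem confinedQuasiGiantsVanish_of_finiteClusterTail :
    (∃ c₀ C : ℝ, 0 < c₀ ∧ ∀ s : ℝ, 1 ≤ s →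
      (bondPercolation (zdGraph 3) (criticalProbI 3)).real
        {ω | (openCluster ω (0 : Site 3)).Finite ∧ s ≤ ((openCluster ω (0 : Site 3)).ncard : ℝ)}
        ≤ C * s ^ (-c₀)) →
    ∃ a : ℝ, 0 < a ∧ Tendsto (fun n : ℕ =>
      (bondPercolation (zdGraph 3) (criticalProbI 3)).real
          {ω | ∃ u ∈ box 3 n,
            (∀ w ∈ innerBoundary (zdGraph 3) (box 3 n), ω ∉ openConnIn ↑(box 3 n) u w) ∧
            (n : ℝ) ^ (3 - a) ≤
              (((box 3 n).filter fun v => ω ∈ openConnIn ↑(box 3 n) u v).card : ℝ)}) atTop (𝓝 0) := by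
  rintro ⟨c₀, C, hc₀, hT⟩
  set a : ℝ := min c₀ 1 / 2 with ha_def
  have hmin : 0 < min c₀ 1 := lt_min hc₀ one_pos
  have ha : 0 < a := by rw [ha_def]; linarith
  have ha1 : a ≤ 1 / 2 := by
    rw [ha_def]; linarith [min_le_right c₀ 1]
  have hac : a ≤ c₀ / 2 := by
    rw [ha_def]; linarith [min_le_left c₀ 1]
  apply FreeBoxPowerSavingLine.confinedQuasiGiantsVanish_of_centredRate
  refine ⟨a, ha, ?_⟩
  set μ := bondPercolation (zdGraph 3) (criticalProbI 3) with hμ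
  set e : ℝ := (3 - a) * c₀ - a with he_def
  have he : 0 < e := by rw [he_def]; nlinarith
  have hlim : Tendsto (fun n : ℕ => max C 0 * (n : ℝ) ^ (-e)) atTop (𝓝 0) := by
    have h := ((tendsto_rpow_neg_atTop he).comp tendsto_natCast_atTop_atTop).const_mul (max C 0)
    simpa using h
  refine tendsto_of_tendsto_of_tendsto_of_le_of_le' tendsto_const_nhds hlim
    (Eventually.of_forall fun n => by positivity) ?_
  filter_upwards [eventually_ge_atTop 1] with n hn1
  have hN1 : (1 : ℝ) ≤ n := by exact_mod_cast hn1
  have hN0 : (0 : ℝ) < n := by linarith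
  -- the centred event lies inside the finite-cluster tail event at `s = n^{3-a}`
  have hsub : {ω : BondConfig (Site 3) | (n : ℝ) ^ (3 - a) ≤
        (((box 3 (2 * n)).filter fun y => ω ∈ openConn 0 y).card : ℝ) ∧
        openCluster ω 0 ⊆ ↑(box 3 (2 * n))} ⊆
      {ω | (openCluster ω (0 : Site 3)).Finite ∧
        (n : ℝ) ^ (3 - a) ≤ ((openCluster ω (0 : Site 3)).ncard : ℝ)} := by
    rintro ω ⟨hcard, hconf⟩
    have hfin : (openCluster ω (0 : Site 3)).Finite := (Finset.finite_toSet _).subset hconf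
    refine ⟨hfin, hcard.trans ?_⟩
    have hF : (↑((box 3 (2 * n)).filter fun y => ω ∈ openConn 0 y) : Set (Site 3)) ⊆
        openCluster ω 0 := by
      intro y hy
      rw [Finset.coe_filter] at hy
      exact hy.2
    exact_mod_cast (Set.ncard_coe_finset _).symm.le.trans (Set.ncard_le_ncard hF hfin)
  have hs1 : (1 : ℝ) ≤ (n : ℝ) ^ (3 - a) := Real.one_le_rpow hN1 (by linarith)
  have hP := (measureReal_mono hsub (measure_ne_top μ _)).trans (hT _ hs1)
  have hpow : ((n : ℝ) ^ (3 - a)) ^ (-c₀) = (n : ℝ) ^ (-((3 - a) * c₀)) := by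
    rw [← Real.rpow_mul hN0.le]; ring_nf
  rw [hpow] at hP
  have hnn : 0 ≤ (n : ℝ) ^ (-((3 - a) * c₀)) := Real.rpow_nonneg hN0.le _
  calc (n : ℝ) ^ a * μ.real {ω | (n : ℝ) ^ (3 - a) ≤
          (((box 3 (2 * n)).filter fun y => ω ∈ openConn 0 y).card : ℝ) ∧
          openCluster ω 0 ⊆ ↑(box 3 (2 * n))}
      ≤ (n : ℝ) ^ a * (max C 0 * (n : ℝ) ^ (-((3 - a) * c₀))) := by
        refine mul_le_mul_of_nonneg_left (hP.trans ?_) (Real.rpow_nonneg hN0.le _)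
        exact mul_le_mul_of_nonneg_right (le_max_left _ _) hnn
    _ = max C 0 * ((n : ℝ) ^ a * (n : ℝ) ^ (-((3 - a) * c₀))) := by ring
    _ = max C 0 * (n : ℝ) ^ (-e) := by
        rw [← Real.rpow_add hN0]; congr 1; rw [he_def]; ring_nf


end Summit.CriticalPhenomena.PercolationContinuityZ3.FreeBoxPowerSavingLine

end
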